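import Literature.MathematicalPhysics.PowerSystems.NonMinimumEquilibriumInstability
import Literature.MathematicalPhysics.PowerSystems.PhaseCohesiveEquilibriumUniqueness
import HarnessLib

/-!
# «Normal operation ⇒ stable»: Corollary 1 of Manik–Timme–Witthaut (2017), verbatim and
# census-free, for the motions of the damped lossless swing model on ANY connected network

Topic `Literature/MathematicalPhysics/PowerSystems`, namespace
`Literature.MathematicalPhysics.PowerSystems.ClassicalModel.LosslessSystem`. A short companion of
`NonMinimumEquilibriumInstability.lean` (§10–§11 there: a (transversally) positive definite Hesse
form of the potential isolates a solution of the power-balance equations (2) and makes it a stable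
rest point / synchronous solution, with no isolation or census hypothesis) and of
`PhaseCohesiveEquilibriumUniqueness.lean` (the tree's connectivity notions `CouplingConnected C` —
every cut of the machine set is crossed by a line with `Cᵢⱼ > 0` — and `CouplingConnectedToBus C K`,
with `exists_const_of_lineAngles_eq` / `eq_of_lineAngles_eq_withInfiniteBuses`: equal values across
every line force a constant / zero vector). Everything below is PROVED (no definition, no named
fact, no new axiom).

SOURCE (read on the page). D. Manik, M. Timme, D. Witthaut, *Cycle flows and multistability in
oscillatory networks*, Chaos 27 (2017) 083123 [ManikTimmeWitthaut2017] (`lit read 10.1063/1.4994177`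
= arXiv:1611.09825, chunk p0004 L68–L77): **Corollary 1.** «Consider a simply connected network. A
fixed point θ* is transversally asymptotically stable if cos(θ*ᵢ − θ*ⱼ) > 0 holds for all edges
(i, j) in the network. Then the network is said to be "normal operation".» Printed proof: in normal
operation the Hesse matrix `M(θ*)` is the Laplacian of the meta-graph with the positive residual
capacities `Kᵢⱼcos(θ*ᵢ − θ*ⱼ)` as weights, positive semi-definite with kernel `(1,…,1)` on a
connected graph; then Lemma 1 (all `μ_k > 0`, `k ≥ 2`).

## What is proved

* `hessForm_pos_of_cohesive_of_connected` (no infinite bus; `Cᵢⱼ ≥ 0` off the diagonal,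
  `CouplingConnected C`): positive cosine on every line ⇒ the Hesse form
  `Q(θe; v) = ½ΣΣ Cᵢⱼcos(θeᵢ − θeⱼ)(vᵢ − vⱼ)²` is positive on every non-constant direction — the
  printed Laplacian step, on the quadratic form.
* **`stable_syncSolution_of_normalOperation`** (no infinite bus; `Mᵢ, Dᵢ > 0`, `C` symmetric): a
  synchronous state (`Pₖ − Dₖω_s = flowₖ(θe)`) in normal operation on a connected network is a
  STABLE synchronous solution: for every `ε > 0` there is `δ > 0` such that every motion from the
  `δ`-ball around `(θe, ω_s𝟙)` keeps its synchronous-frame orbit within `ε` of `(θe, 0)` and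
  converges to `(θe + a𝟙, 0)`, `a` the rotation offset of its own momentum leaf («transversally
  asymptotically stable») — via `stable_syncSolution_of_hessForm_posDef`.
* `hessForm_posDef_of_cohesive_of_connectedToBus`, **`stable_rest_of_normalOperation`** (with
  infinite buses, network connected through its buses, `Kᵢb ≥ 0`): positive cosines on every
  machine line and bus line ⇒ positive definite form ⇒ the rest point `(θe, 0)` is stable and
  attracting — via `stable_rest_of_hessForm_posDef`.
* (append) `couplingConnected_of_forall_pos` (complete positive coupling, the Kron-reduced case)
  and `couplingConnected_of_rootedTree` (a rooted spanning tree of positive lines) — the two ways a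
  record discharges `CouplingConnected C` in one line.

DEVIATION FROM THE PRINTED PROOF: none in substance (Laplacian positivity + Lemma 1); Lemma 1 itself
is used in its energy form (`NonMinimumEquilibriumInstability` §10–§11: compact sphere, tube lemma,
segment convexity, Barbashin–Krasovskii–LaSalle well on the momentum leaf) instead of the spectrum of
the linearisation, so the conclusion is nonlinear Lyapunov stability plus convergence, with no
isolation, census or tree hypothesis.

THREE COLUMNS (LADDER-GRIDFUSION honest framing). CERTIFIED for MODEL `M` = damped lossless
network-reduced swing model (`Mᵢ, Dᵢ > 0`, symmetric non-negative couplings; MODEL-VALIDITY MV-1),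
any connected network; CLASS `C` = the `δ`-ball around the synchronous solution / rest point.
«Stable» refers to the synchronous solution of MODEL `M`, never to a grid. NOT CLAIMED: the size of
`δ`; exponential rates (spectral route: `StructurePreservingSyncExponentialStability` for the
structure-preserving tier); anything for states outside normal operation (see §10–§11 of the
companion for the Hessian test, §3 for instability).
-/

noncomputable section

open Real Set Filter Topology Metric Finset

namespace Literature.MathematicalPhysics.PowerSystems

namespace ClassicalModel

/-! ### COROLLARY 1 OF MANIK–TIMME–WITTHAUT, VERBATIM AND CENSUS-FREE: on a
CONNECTED network a synchronous state in «normal operation» (`cos(θ*ᵢ − θ*ⱼ) > 0` on every edge) is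
(transversally) asymptotically STABLE — for the motions of the damped swing model, any network

«Corollary 1. Consider a simply connected network. A fixed point θ* is transversally
asymptotically stable if cos(θ*ᵢ − θ*ⱼ) > 0 holds for all edges (i, j) in the network. Then the
network is said to be in "normal operation".» (p0004). Proof here: positive residual capacities on a
connected coupling graph (`CouplingConnected`, the tree's cut form of connectivity) make the Hesse
form vanish only on constant directions (`exists_const_of_lineAngles_eq`), i.e. transversally
positive definite; then `NonMinimumEquilibriumInstability` §11. With infinite buses (`CouplingConnectedToBus`) the form is positive
definite outright (`eq_of_lineAngles_eq_withInfiniteBuses`) and the rest point itself is stable and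
attracting. No isolation, no census, no tree structure. -/

namespace LosslessSystem

section NoBus

variable {n : ℕ} (S : LosslessSystem n 0)

/-- **Normal operation on a connected network ⇒ transversally positive definite Hesse form** (no
infinite bus; couplings `Cᵢⱼ ≥ 0` off the diagonal, `CouplingConnected C`): if `cos(θeᵢ − θeⱼ) > 0`
on every edge (`Cᵢⱼ > 0`), then `Q(θe; v) = ½ΣΣ Cᵢⱼcos(θeᵢ − θeⱼ)(vᵢ − vⱼ)² > 0` for every
non-constant `v` («M is a Laplacian matrix … eigenvalue 0 only for (1,…,1)»).
[cite: ManikTimmeWitthaut2017, §3 Lemma 1 proof and Cor. 1; DorflerChertkovBullo2013, SI §3.1 Lemma 2 (nullspace 𝟙ₙ)] -/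
theorem hessForm_pos_of_cohesive_of_connected (hC0 : ∀ i j, i ≠ j → 0 ≤ S.C i j)
    (hconn : CouplingConnected S.C) {θe : Fin n → ℝ}
    (hcoh : ∀ i j, i ≠ j → 0 < S.C i j → 0 < Real.cos (θe i - θe j))
    (v : Fin n → ℝ) (hv : ∃ i j, v i ≠ v j) :
    0 < 1 / 2 * ∑ i, ∑ j, S.C i j * Real.cos (θe i - θe j) * (v i - v j) ^ 2
        + ∑ i, ∑ b, S.K i b * Real.cos (θe i - S.β b) * v i ^ 2 := by
  have hterm : ∀ i j, 0 ≤ S.C i j * Real.cos (θe i - θe j) * (v i - v j) ^ 2 := by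
    intro i j
    by_cases hij : i = j
    · subst hij
      simp
    · rcases (hC0 i j hij).eq_or_lt with h0 | hpos
      · rw [← h0]
        simp
      · exact mul_nonneg (mul_pos hpos (hcoh i j hij hpos)).le (sq_nonneg _)
  have hsum0 : 0 ≤ ∑ i, ∑ j, S.C i j * Real.cos (θe i - θe j) * (v i - v j) ^ 2 :=
    Finset.sum_nonneg fun i _ => Finset.sum_nonneg fun j _ => hterm i j
  have hbus : ∑ i, ∑ b, S.K i b * Real.cos (θe i - S.β b) * v i ^ 2 = 0 := by
    simp only [Fin.sum_univ_zero, Finset.sum_const_zero]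
  rw [hbus, add_zero]
  rcases hsum0.eq_or_lt with hzero | hpos
  · -- all terms vanish: `v` is constant across every edge, hence constant (connectivity)
    exfalso
    have hall : ∀ i j, S.C i j * Real.cos (θe i - θe j) * (v i - v j) ^ 2 = 0 := by
      intro i j
      have h1 := (Finset.sum_eq_zero_iff_of_nonneg fun i _ =>
        Finset.sum_nonneg fun j _ => hterm i j).1 hzero.symm i (Finset.mem_univ i)
      exact (Finset.sum_eq_zero_iff_of_nonneg fun j _ => hterm i j).1 h1 j (Finset.mem_univ j)
    have hline : ∀ i j, i ≠ j → 0 < S.C i j → v i - v j = (0 : Fin n → ℝ) i - (0 : Fin n → ℝ) j := by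
      intro i j hij hc
      have h := hall i j
      rcases mul_eq_zero.1 h with h1 | h1
      · exact absurd h1 (mul_pos hc (hcoh i j hij hc)).ne'
      · have : v i - v j = 0 := by simpa using h1
        simp [this]
    obtain ⟨c, hc⟩ := ClassicalModel.exists_const_of_lineAngles_eq hconn hline
    obtain ⟨i, j, hij⟩ := hv
    exact hij (by rw [hc i, hc j]; simp)
  · positivity

/-- **COROLLARY 1, VERBATIM, FOR THE MOTIONS (no infinite bus; `Mᵢ, Dᵢ > 0`, `C` symmetric with
non-negative entries, connected coupling graph): a synchronous state in «normal operation»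
(`cos(θeᵢ − θeⱼ) > 0` on every edge) is a STABLE synchronous solution of the damped swing model** —
every motion from a `δ`-ball around `(θe, ω_s𝟙)` stays `ε`-close to the synchronous solution and
locks onto a rotated copy («transversally asymptotically stable»). NO isolation, NO census, NO tree
hypothesis: meshed networks included. THREE COLUMNS: CERTIFIED for MODEL `M` = damped lossless
network-reduced swing model (MV-1); CLASS = the `δ`-ball; «stable» = the synchronous solution of
MODEL `M`, never a grid.
[cite: ManikTimmeWitthaut2017, §3 Cor. 1 («Consider a simply connected network. A fixed point θ* is transversally asymptotically stable if cos(θ*_i − θ*_j) > 0 holds for all edges (i,j) in the network»); DorflerChertkovBullo2013, SI §3.1 Lemma 2; Padiyar2013, App. B.2.1 (3)] -/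
theorem stable_syncSolution_of_normalOperation (hC : ∀ i j, S.C i j = S.C j i)
    (hC0 : ∀ i j, i ≠ j → 0 ≤ S.C i j) (hconn : CouplingConnected S.C)
    (hM : ∀ i, 0 < S.M i) (hD : ∀ i, 0 < S.D i) {θe : Fin n → ℝ}
    (he : ∀ i, S.P i - S.D i * ((∑ j, S.P j) / ∑ j, S.D j) = S.flow θe i)
    (hcoh : ∀ i j, i ≠ j → 0 < S.C i j → 0 < Real.cos (θe i - θe j)) {ε : ℝ} (hε : 0 < ε) :
    ∃ δ > 0, ∀ x₁ : (Fin n → ℝ) × (Fin n → ℝ),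
      dist x₁ (θe, fun _ => (∑ j, S.P j) / ∑ j, S.D j) < δ →
      (∃ X : ℝ → (Fin n → ℝ) × (Fin n → ℝ), X 0 = x₁ ∧
          ∀ T : ℝ, ∀ t ∈ Icc 0 T, HasDerivWithinAt X (S.field (X t)) (Icc 0 T) t) ∧
        ∀ X : ℝ → (Fin n → ℝ) × (Fin n → ℝ), X 0 = x₁ →
          (∀ T : ℝ, ∀ t ∈ Icc 0 T, HasDerivWithinAt X (S.field (X t)) (Icc 0 T) t) →
          (∀ t, 0 ≤ t → dist ((fun j => (X t).1 j - (∑ j, S.P j) / (∑ j, S.D j) * t),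
              (fun j => (X t).2 j - (∑ j, S.P j) / ∑ j, S.D j)) (θe, 0) < ε) ∧
          Tendsto (fun t => ((fun j => (X t).1 j - (∑ j, S.P j) / (∑ j, S.D j) * t),
              (fun j => (X t).2 j - (∑ j, S.P j) / ∑ j, S.D j))) atTop
            (𝓝 ((fun j => θe j + (∑ i, (S.M i * (x₁.2 i - (∑ j, S.P j) / ∑ j, S.D j)
              + S.D i * (x₁.1 i - θe i))) / ∑ i, S.D i), 0)) := by
  refine S.stable_syncSolution_of_hessForm_posDef hC hM hD he (fun v hv => ?_) hε
  have h := S.hessForm_pos_of_cohesive_of_connected hC0 hconn hcoh v hv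
  simpa only [Fin.sum_univ_zero, Finset.sum_const_zero, add_zero] using h

end NoBus

section AnyBus

variable {n m : ℕ} (S : LosslessSystem n m)

/-- **Normal operation on a network connected through its infinite buses ⇒ positive definite Hesse
form** (`Cᵢⱼ ≥ 0` off the diagonal, `Kᵢb ≥ 0`, `CouplingConnectedToBus C K`): positive cosines on
every machine line and every bus line make `Q(θe; v) > 0` for all `v ≠ 0` (equal `v` across the
machine lines, zero at bus-connected machines, hence zero: `eq_of_lineAngles_eq_withInfiniteBuses`).
[cite: ManikTimmeWitthaut2017, §3 Cor. 1; DvijothamLowChertkov2015, §3.3 Cor. 1 (slack bus pinned)] -/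
theorem hessForm_posDef_of_cohesive_of_connectedToBus (hC0 : ∀ i j, i ≠ j → 0 ≤ S.C i j)
    (hK0 : ∀ i b, 0 ≤ S.K i b) (hconn : CouplingConnectedToBus S.C S.K) {θe : Fin n → ℝ}
    (hcoh : ∀ i j, i ≠ j → 0 < S.C i j → 0 < Real.cos (θe i - θe j))
    (hcohK : ∀ i b, 0 < S.K i b → 0 < Real.cos (θe i - S.β b))
    (v : Fin n → ℝ) (hv : v ≠ 0) :
    0 < 1 / 2 * ∑ i, ∑ j, S.C i j * Real.cos (θe i - θe j) * (v i - v j) ^ 2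
        + ∑ i, ∑ b, S.K i b * Real.cos (θe i - S.β b) * v i ^ 2 := by
  have hterm : ∀ i j, 0 ≤ S.C i j * Real.cos (θe i - θe j) * (v i - v j) ^ 2 := by
    intro i j
    by_cases hij : i = j
    · subst hij
      simp
    · rcases (hC0 i j hij).eq_or_lt with h0 | hpos
      · rw [← h0]
        simp
      · exact mul_nonneg (mul_pos hpos (hcoh i j hij hpos)).le (sq_nonneg _)
  have htermK : ∀ i b, 0 ≤ S.K i b * Real.cos (θe i - S.β b) * v i ^ 2 := by
    intro i b
    rcases (hK0 i b).eq_or_lt with h0 | hpos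
    · rw [← h0]
      simp
    · exact mul_nonneg (mul_pos hpos (hcohK i b hpos)).le (sq_nonneg _)
  have hA : 0 ≤ ∑ i, ∑ j, S.C i j * Real.cos (θe i - θe j) * (v i - v j) ^ 2 :=
    Finset.sum_nonneg fun i _ => Finset.sum_nonneg fun j _ => hterm i j
  have hB : 0 ≤ ∑ i, ∑ b, S.K i b * Real.cos (θe i - S.β b) * v i ^ 2 :=
    Finset.sum_nonneg fun i _ => Finset.sum_nonneg fun b _ => htermK i b
  have hQ : 0 ≤ 1 / 2 * ∑ i, ∑ j, S.C i j * Real.cos (θe i - θe j) * (v i - v j) ^ 2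
      + ∑ i, ∑ b, S.K i b * Real.cos (θe i - S.β b) * v i ^ 2 := by positivity
  rcases hQ.eq_or_lt with hzero | hpos
  · exfalso
    have hA0 : ∑ i, ∑ j, S.C i j * Real.cos (θe i - θe j) * (v i - v j) ^ 2 = 0 := by linarith
    have hB0 : ∑ i, ∑ b, S.K i b * Real.cos (θe i - S.β b) * v i ^ 2 = 0 := by linarith
    have hall : ∀ i j, S.C i j * Real.cos (θe i - θe j) * (v i - v j) ^ 2 = 0 := by
      intro i j
      have h1 := (Finset.sum_eq_zero_iff_of_nonneg fun i _ =>
        Finset.sum_nonneg fun j _ => hterm i j).1 hA0 i (Finset.mem_univ i)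
      exact (Finset.sum_eq_zero_iff_of_nonneg fun j _ => hterm i j).1 h1 j (Finset.mem_univ j)
    have hallK : ∀ i b, S.K i b * Real.cos (θe i - S.β b) * v i ^ 2 = 0 := by
      intro i b
      have h1 := (Finset.sum_eq_zero_iff_of_nonneg fun i _ =>
        Finset.sum_nonneg fun b _ => htermK i b).1 hB0 i (Finset.mem_univ i)
      exact (Finset.sum_eq_zero_iff_of_nonneg fun b _ => htermK i b).1 h1 b (Finset.mem_univ b)
    have hline : ∀ i j, i ≠ j → 0 < S.C i j → v i - v j = (0 : Fin n → ℝ) i - (0 : Fin n → ℝ) j := by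
      intro i j hij hc
      rcases mul_eq_zero.1 (hall i j) with h1 | h1
      · exact absurd h1 (mul_pos hc (hcoh i j hij hc)).ne'
      · have : v i - v j = 0 := by simpa using h1
        simp [this]
    have hbus : ∀ i b, 0 < S.K i b → v i = (0 : Fin n → ℝ) i := by
      intro i b hk
      rcases mul_eq_zero.1 (hallK i b) with h1 | h1
      · exact absurd h1 (mul_pos hk (hcohK i b hk)).ne'
      · simpa using h1
    exact hv (ClassicalModel.eq_of_lineAngles_eq_withInfiniteBuses hconn hline hbus)
  · exact hpos

/-- **COROLLARY 1 WITH INFINITE BUSES, FOR THE MOTIONS (any `m ≥ 1` in effect; `Mᵢ, Dᵢ > 0`, `C`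
symmetric, non-negative couplings, network connected through its buses): a solution of (2) in
«normal operation» — positive cosine on every machine line and every bus line — is a STABLE AND
ATTRACTING rest point.** No isolation, no census.
[cite: ManikTimmeWitthaut2017, §3 Cor. 1; Padiyar2013, App. B.2.1 (3); Chiang1995, §1 p. 44] -/
theorem stable_rest_of_normalOperation (hC : ∀ i j, S.C i j = S.C j i)
    (hC0 : ∀ i j, i ≠ j → 0 ≤ S.C i j) (hK0 : ∀ i b, 0 ≤ S.K i b)
    (hconn : CouplingConnectedToBus S.C S.K) (hM : ∀ i, 0 < S.M i) (hD : ∀ i, 0 < S.D i)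
    {θe : Fin n → ℝ} (he : S.IsEquilibrium θe)
    (hcoh : ∀ i j, i ≠ j → 0 < S.C i j → 0 < Real.cos (θe i - θe j))
    (hcohK : ∀ i b, 0 < S.K i b → 0 < Real.cos (θe i - S.β b)) {ε : ℝ} (hε : 0 < ε) :
    ∃ δ > 0, ∀ x₁ : (Fin n → ℝ) × (Fin n → ℝ), dist x₁ (θe, 0) < δ →
      (∃ X : ℝ → (Fin n → ℝ) × (Fin n → ℝ), X 0 = x₁ ∧
          ∀ T : ℝ, ∀ t ∈ Icc 0 T, HasDerivWithinAt X (S.field (X t)) (Icc 0 T) t) ∧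
        ∀ X : ℝ → (Fin n → ℝ) × (Fin n → ℝ), X 0 = x₁ →
          (∀ T : ℝ, ∀ t ∈ Icc 0 T, HasDerivWithinAt X (S.field (X t)) (Icc 0 T) t) →
          (∀ t, 0 ≤ t → dist (X t) (θe, 0) < ε) ∧ Tendsto X atTop (𝓝 (θe, 0)) :=
  S.stable_rest_of_hessForm_posDef hC hM hD he
    (S.hessForm_posDef_of_cohesive_of_connectedToBus hC0 hK0 hconn hcoh hcohK) hε

end AnyBus

end LosslessSystem

/-! ### Discharging `CouplingConnected` for records (plumbing for one-line instances) -/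

/-- **Complete positive coupling is connected**: if every off-diagonal coupling is positive (the
Kron-reduced classical models: all transfer susceptances present), `CouplingConnected C` holds.
[cite: DorflerChertkovBullo2013, SI §3.1 Lemma 2 (hypothesis «connected graph»; complete coupling graphs of network-reduced models)] -/
theorem couplingConnected_of_forall_pos {n : ℕ} {C : Fin n → Fin n → ℝ}
    (h : ∀ i j, i ≠ j → 0 < C i j) : CouplingConnected C := by
  intro S hS hSc
  obtain ⟨i, hi⟩ := hS
  obtain ⟨j, hj⟩ := hSc
  have hij : i ≠ j := by
    rintro rfl
    exact (Finset.mem_compl.1 hj) hi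
  exact ⟨i, hi, j, hj, h i j hij⟩

/-- **A rooted spanning tree of positive lines makes the coupling graph connected**: with a parent
map (`parent root = root`, depths increasing away from the root) and `C_{i, parent i} > 0` for every
`i ≠ root` (`C` symmetric), every cut of the machine set is crossed by a positive line — the
hypothesis `CouplingConnected C` of `stable_syncSolution_of_normalOperation` for radial records and
for any record with an exhibited spanning tree.
[cite: DorflerChertkovBullo2013, SI §3.1 Lemma 2 (connected graph) and §3.2 Thm 2 (acyclic networks); ManikTimmeWitthaut2017, §3 Cor. 1] -/
theorem couplingConnected_of_rootedTree {n : ℕ} {root : Fin n} {parent : Fin n → Fin n}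
    {depth : Fin n → ℕ} (hdepth : ∀ i, i ≠ root → depth i = depth (parent i) + 1)
    {C : Fin n → Fin n → ℝ} (hC : ∀ i j, C i j = C j i)
    (ha : ∀ i, i ≠ root → 0 < C i (parent i)) : CouplingConnected C := by
  intro S hS hSc
  by_contra hno
  push Not at hno
  -- no positive line crosses the cut: membership in `S` is inherited from the parent
  have hpar : ∀ i, i ≠ root → (i ∈ S ↔ parent i ∈ S) := by
    intro i hi
    constructor
    · intro hiS
      by_contra hp
      have h := hno i hiS (parent i) (Finset.mem_compl.2 hp)
      exact absurd (ha i hi) (not_lt.2 h)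
    · intro hpS
      by_contra hiS
      have h := hno (parent i) hpS i (Finset.mem_compl.2 hiS)
      rw [hC] at h
      exact absurd (ha i hi) (not_lt.2 h)
  -- hence every machine is in `S` iff the root is (induction on the depth)
  have hall : ∀ d : ℕ, ∀ i, depth i = d → (i ∈ S ↔ root ∈ S) := by
    intro d
    induction d using Nat.strong_induction_on with
    | _ d ih =>
      intro i hdi
      by_cases hi : i = root
      · rw [hi]
      · have hd := hdepth i hi
        have hlt : depth (parent i) < d := by omega
        rw [hpar i hi]
        exact ih (depth (parent i)) hlt (parent i) rfl
  obtain ⟨i, hi⟩ := hS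
  obtain ⟨j, hj⟩ := hSc
  have hroot : root ∈ S := (hall (depth i) i rfl).1 hi
  have hjS : j ∈ S := (hall (depth j) j rfl).2 hroot
  exact (Finset.mem_compl.1 hj) hjS

end ClassicalModel

end Literature.MathematicalPhysics.PowerSystems
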